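import Summits.QuantumAdvantage.QuantumAdvantage.Theorems.LinnikCubicClassGroupsDegreeOnePrimesEscapeRayClassDegOne
import HarnessLib

/-!
# Linnik's theorem for cosets of a congruence class group, XVI: a Siegel-free lower bound of the right order in `x`

Topic `Summits/QuantumAdvantage/QuantumAdvantage/Theorems`, cell B2b-1 (linnik-cubic), PART A (gen 25); helper toward
the crux `DegreeOnePrimesEscape` (stmt-QuantumAdvantage-11543) of route `LinnikCubicClassGroups`.  HONEST FRAMING: the
value of this file is a THEOREM (kernel-checked, GRH-free, Siegel-free) — NOT summit progress (the route still rests on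
the hypothesis-type target `PureCubicClassNumberHard`).

For a number field `K` of degree `n > 1` and an abelian Frobenius datum `f : 𝔭 ↦ f 𝔭 ∈ G` killing the narrow ray
`mod 𝔪 ≠ 0`, with non-trivial characters non-principal off `𝔪` and `|G| ≤ Q_𝔪⁴` (`Q_𝔪 = |d_K| n^n N𝔪`):
* `fiberTheta_ge` — **`|G| θ_τ(x) ≥ c(n) Q_𝔪^{−8} x` for every coset `τ` and every `x ≥ Q_𝔪^{L(n)}`**,
  unconditionally: in the flat case the Deuring–Heilbronn relative PNT (`thetaFiber_relative`) and the effective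
  repulsion `1 − β₁ ≥ c₁ Q_𝔪^{−8}` of the real zero (`rayRealZero_repulsion`) give
  `x − x^{β₁}/β₁ ≥ (x/4) min(1, (1−β₁) log x)`; otherwise `θ_τ(x) ≥ x/(2|G|)` (step 1 of file X, isolated);
* `fiberPrimeCount_ge` — hence `#{𝔭 ∤ 𝔪 : f 𝔭 = τ, N𝔭 ≤ x} ≥ c Q_𝔪^{−8} x/(|G| log x)`;
* `rayClassPrimeCount_ge` — the canonical case: **every narrow ray class `mod 𝔪` of every number field of degree `n`
  has `≥ c(n) x/(Q_𝔪^{12} log x)` prime ideals of norm `≤ x`, for all `x ≥ Q_𝔪^{L(n)}`** — a lower bound of the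
  right order in `x` with a polynomial loss in `Q_𝔪` in place of Siegel's ineffective constant (cf. the Chebotarev
  analogue `frobeniusClass_theta_ge` of gen 13 and Thorner–Zaman 2017 Thm 3.1, `≫ (D_K Q n_K^{n_K})^{-5} x/(h_H log x)`).
References: [Weiss1983] §6; [ThornerZaman2017] Thm 3.1 (`#{𝔭 ∈ 𝒞 : deg 𝔭 = 1, N𝔭 ≤ x} ≫ (D_K Q n_K^{n_K})^{-5} x/(h_H log x)`
for `x ≥ D_K^{694} Q^{521} + …`); [LagariasMontgomeryOdlyzko1979] Thm 1.1.
-/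

noncomputable section

open Complex Real Set Filter Topology NumberField IsDedekindDomain
open scoped NumberField nonZeroDivisors

namespace Summit.QuantumAdvantage.QuantumAdvantage.Theorems.DegreeOnePrimesEscape

open Literature.NumberTheory.LFunctions Literature.NumberTheory.LFunctions.NumberField
  Literature.NumberTheory.LFunctions.AbelianDensity Literature.NumberTheory.GaloisRepresentations
open scoped Classical

set_option maxHeartbeats 800000 in
/-- **A Siegel-free lower bound for every coset in the Linnik range** (see the module docstring): for `n > 1` there are
`L = L(n) > 0`, `c = c(n) > 0` with `c Q_𝔪^{−8} x ≤ |G| θ_τ(x)` for every datum as above, every coset `τ` and every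
`x ≥ Q_𝔪^L`. [cite: Weiss1983, §6] [cite: ThornerZaman2017, Theorem 3.1] -/
theorem fiberTheta_ge (n : ℕ) (hn : 1 < n) :
    ∃ L c : ℝ, 0 < L ∧ 0 < c ∧ ∀ (K : Type) [Field K] [NumberField K], Module.finrank ℚ K = n →
    ∀ (G : Type) [CommGroup G] [Finite G] (𝔪 : Ideal (𝓞 K)) (f : HeightOneSpectrum (𝓞 K) → G),
      𝔪 ≠ ⊥ → ArtinKillsRay 𝔪 f →
      (∀ χ : AddChar (Additive G) ℂ, χ ≠ 0 →
        ∃ v : HeightOneSpectrum (𝓞 K), ¬ 𝔪 ≤ v.asIdeal ∧ χ (Additive.ofMul (f v)) ≠ 1) →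
      (Nat.card G : ℝ) ≤ rayCondQ K 𝔪 ^ (4 : ℕ) →
      ∀ x : ℝ, rayCondQ K 𝔪 ^ L ≤ x → ∀ τ : G,
        c * rayCondQ K 𝔪 ^ (-(8 : ℝ)) * x ≤ (Nat.card G : ℝ) * fiberTheta 𝔪 f τ x := by
  obtain ⟨a₂, c, ha₂1, hc, hcn, hθ⟩ := thetaFiber_relative n hn (by norm_num : (0 : ℝ) < 1 / 2)
  obtain ⟨c₁, hc₁, hc₁1, hrep⟩ := rayRealZero_repulsion n hn
  refine ⟨max a₂ 8, c₁ / 8, by positivity, by positivity, fun K _ _ hKn G _ _ 𝔪 f h𝔪 hray hsep hG x hx τ ↦ ?_⟩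
  have hK : 1 < Module.finrank ℚ K := by rw [hKn]; exact hn
  set R : ℝ := rayCondQ K 𝔪 with hR
  have hR12 : (12 : ℝ) ≤ R := twelve_le_rayCondQ hK h𝔪
  have hR1 : (1 : ℝ) < R := by linarith
  have hR0 : (0 : ℝ) < R := by linarith
  have hlogR : 2 ≤ Real.log R := two_lt_log_twelve.le.trans (Real.log_le_log (by norm_num) hR12)
  have hxa₂ : R ^ a₂ ≤ x := (Real.rpow_le_rpow_of_exponent_le hR1.le (le_max_left a₂ 8)).trans hx
  have hx8 : R ^ (8 : ℝ) ≤ x := (Real.rpow_le_rpow_of_exponent_le hR1.le (le_max_right a₂ 8)).trans hx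
  have hxR : R ≤ x := by
    have := Real.rpow_le_rpow_of_exponent_le hR1.le (show (1 : ℝ) ≤ max a₂ 8 by linarith [le_max_right a₂ 8])
    rw [Real.rpow_one] at this; exact this.trans hx
  have hx1 : (1 : ℝ) < x := by linarith
  have hx0 : 0 < x := by linarith
  have hL16 : 16 ≤ Real.log x := by
    have h1 : Real.log (R ^ (8 : ℝ)) ≤ Real.log x := Real.log_le_log (Real.rpow_pos_of_pos hR0 _) hx8
    rw [Real.log_rpow hR0] at h1
    linarith
  have hlogx1 : 1 ≤ Real.log x := by linarith
  set h : ℝ := (Nat.card G : ℝ) with hh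
  have hh1 : 1 ≤ h := by
    rw [hh]; exact_mod_cast Nat.one_le_iff_ne_zero.2 (Nat.card_pos (α := G)).ne'
  have hh0 : 0 < h := by linarith
  have hRm8' : 0 < R ^ (-(8 : ℝ)) := Real.rpow_pos_of_pos hR0 _
  have hRm8 : R ^ (-(8 : ℝ)) ≤ 1 := Real.rpow_le_one_of_one_le_of_nonpos hR1.le (by norm_num)
  set m' : ℝ := c₁ * R ^ (-(8 : ℝ)) with hm'
  have hm'0 : 0 < m' := mul_pos hc₁ hRm8'
  have hm'1 : m' ≤ 1 := (mul_le_mul hc₁1 hRm8 hRm8'.le zero_le_one).trans (by norm_num)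
  -- `θ_τ(x) ≥ x m' / (8 h)`
  have hθlow : x * m' / (8 * h) ≤ fiberTheta 𝔪 f τ x := by
    have hcmp : x * m' / (8 * h) ≤ x / h - 1 / 2 * x / h := by
      rw [show x / h - 1 / 2 * x / h = x * 4 / (8 * h) by field_simp; ring]
      exact div_le_div_of_nonneg_right (mul_le_mul_of_nonneg_left (by linarith) hx0.le) (by positivity)
    rcases hθ K hKn G 𝔪 f h𝔪 hray hsep hG with hgood | ⟨ψ₁, β₁, hz, hβlow, hβ1, hreal, hexc⟩
    · have h1 := (abs_sub_le_iff.1 (hgood x hxa₂ τ)).2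
      linarith
    · obtain ⟨hM0, hb⟩ := hexc x hxa₂ τ
      have h1 := (abs_sub_le_iff.1 hb).2
      have hδ : m' ≤ 1 - β₁ := hrep K hKn G 𝔪 f h𝔪 hray hsep ψ₁ hreal β₁ hβ1 hz
      have hβ34 : 3 / 4 ≤ β₁ := by
        have hlog4 : 1 < Real.log 4 := by
          rw [show (4:ℝ) = 2 ^ 2 by norm_num, Real.log_pow]; have := Real.log_two_gt_d9; push_cast; linarith
        have hlogd : 0 ≤ Real.log (((discr K).natAbs : ℝ) * ((Ideal.absNorm 𝔪 : ℕ) : ℝ)) :=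
          Real.log_nonneg (one_le_discr_mul_absNorm K h𝔪)
        have hc4 : c ≤ 1 / 4 := by
          refine hcn.trans ?_
          rw [div_le_div_iff_of_pos_left one_pos (by positivity) (by norm_num)]
          have := sq_nonneg (n : ℝ); linarith
        have : c / (Real.log (((discr K).natAbs : ℝ) * ((Ideal.absNorm 𝔪 : ℕ) : ℝ)) + Real.log 4) ≤ 1 / 4 := by
          rw [div_le_iff₀ (by linarith)]; nlinarith
        linarith
      have hr := (addChar_real_apply hreal (Additive.ofMul τ)).2.2
      have hM := sub_mul_rpow_div_ge hx1 hL16 hβ34 hβ1 hr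
      have hmin : m' ≤ min 1 ((1 - β₁) * Real.log x) := by
        refine le_min hm'1 (hδ.trans ?_)
        have := mul_le_mul_of_nonneg_left hlogx1 (by linarith : (0 : ℝ) ≤ 1 - β₁); linarith
      set M : ℝ := x - (ψ₁ (Additive.ofMul τ)).re * x ^ β₁ / β₁ with hMdef
      have hM' : x / 4 * m' ≤ M := le_trans (mul_le_mul_of_nonneg_left hmin (by positivity)) hM
      have h2 : x * m' / (8 * h) ≤ M / h - 1 / 2 * M / h := by
        rw [show M / h - 1 / 2 * M / h = M * 4 / (8 * h) by field_simp; ring]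
        exact div_le_div_of_nonneg_right (by linarith) (by positivity)
      linarith
  have e : c₁ / 8 * R ^ (-(8 : ℝ)) * x = h * (x * m' / (8 * h)) := by
    rw [hm']; field_simp
  rw [e]
  exact mul_le_mul_of_nonneg_left hθlow hh0.le

/-- **The prime count of every coset is `≥ c Q_𝔪^{−8} x/(|G| log x)`** for `x ≥ Q_𝔪^L` (`π_τ(x) ≥ θ_τ(x)/log x`).
[cite: Weiss1983, §6] [cite: ThornerZaman2017, Theorem 3.1] -/
theorem fiberPrimeCount_ge (n : ℕ) (hn : 1 < n) :
    ∃ L c : ℝ, 0 < L ∧ 0 < c ∧ ∀ (K : Type) [Field K] [NumberField K], Module.finrank ℚ K = n →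
    ∀ (G : Type) [CommGroup G] [Finite G] (𝔪 : Ideal (𝓞 K)) (f : HeightOneSpectrum (𝓞 K) → G),
      𝔪 ≠ ⊥ → ArtinKillsRay 𝔪 f →
      (∀ χ : AddChar (Additive G) ℂ, χ ≠ 0 →
        ∃ v : HeightOneSpectrum (𝓞 K), ¬ 𝔪 ≤ v.asIdeal ∧ χ (Additive.ofMul (f v)) ≠ 1) →
      (Nat.card G : ℝ) ≤ rayCondQ K 𝔪 ^ (4 : ℕ) →
      ∀ x : ℝ, rayCondQ K 𝔪 ^ L ≤ x → ∀ τ : G,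
        c * rayCondQ K 𝔪 ^ (-(8 : ℝ)) * x / ((Nat.card G : ℝ) * Real.log x) ≤
          (({v : HeightOneSpectrum (𝓞 K) | ¬ 𝔪 ≤ v.asIdeal ∧ f v = τ ∧
              (Ideal.absNorm v.asIdeal : ℝ) ≤ x}.ncard : ℕ) : ℝ) := by
  obtain ⟨L, c, hL, hc, hmain⟩ := fiberTheta_ge n hn
  refine ⟨max L 1, c, by positivity, hc, fun K _ _ hKn G _ _ 𝔪 f h𝔪 hray hsep hG x hx τ ↦ ?_⟩
  have hK : 1 < Module.finrank ℚ K := by rw [hKn]; exact hn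
  set R : ℝ := rayCondQ K 𝔪 with hR
  have hR12 : (12 : ℝ) ≤ R := twelve_le_rayCondQ hK h𝔪
  have hR1 : (1 : ℝ) ≤ R := by linarith
  have hxL : R ^ L ≤ x := (Real.rpow_le_rpow_of_exponent_le hR1 (le_max_left L 1)).trans hx
  have hxR : R ≤ x := by
    have := Real.rpow_le_rpow_of_exponent_le hR1 (le_max_right L 1)
    rw [Real.rpow_one] at this; exact this.trans hx
  have hlogx : 0 < Real.log x := Real.log_pos (by linarith)
  have hG0 : (0 : ℝ) < (Nat.card G : ℝ) := by exact_mod_cast Nat.card_pos (α := G)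
  have h1 := hmain K hKn G 𝔪 f h𝔪 hray hsep hG x hxL τ
  have h2 := fiberTheta_le_card_mul_log (𝔪 := 𝔪) (f := f) τ x
  rw [div_le_iff₀ (by positivity)]
  calc c * R ^ (-(8 : ℝ)) * x ≤ (Nat.card G : ℝ) * fiberTheta 𝔪 f τ x := h1
    _ ≤ (Nat.card G : ℝ) * ((({v : HeightOneSpectrum (𝓞 K) | ¬ 𝔪 ≤ v.asIdeal ∧ f v = τ ∧
          (Ideal.absNorm v.asIdeal : ℝ) ≤ x}.ncard : ℕ) : ℝ) * Real.log x) := mul_le_mul_of_nonneg_left h2 hG0.le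
    _ = _ := by ring

/-- **Every narrow ray class `mod 𝔪` has `≥ c(n) x/(Q_𝔪^{12} log x)` prime ideals of norm `≤ x`, for all
`x ≥ Q_𝔪^{L(n)}`, unconditionally** (canonical case `G = Cl_K^𝔪`, `|Cl_K^𝔪| ≤ Q_𝔪⁴`). [cite: Weiss1983, §6]
[cite: ThornerZaman2017, Theorem 3.1] -/
theorem rayClassPrimeCount_ge (n : ℕ) (hn : 1 < n) :
    ∃ L c : ℝ, 0 < L ∧ 0 < c ∧ ∀ (K : Type) [Field K] [NumberField K], Module.finrank ℚ K = n →
    ∀ (𝔪 : Ideal (𝓞 K)) (h𝔪 : 𝔪 ≠ ⊥) (τ : RayClassGroup 𝔪),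
      ∀ x : ℝ, rayCondQ K 𝔪 ^ L ≤ x →
        c * x / (rayCondQ K 𝔪 ^ (12 : ℕ) * Real.log x) ≤
          (({v : HeightOneSpectrum (𝓞 K) | ¬ 𝔪 ≤ v.asIdeal ∧ primeRayClass 𝔪 h𝔪 v = τ ∧
              (Ideal.absNorm v.asIdeal : ℝ) ≤ x}.ncard : ℕ) : ℝ) := by
  obtain ⟨L, c, hL, hc, hmain⟩ := fiberPrimeCount_ge n hn
  refine ⟨max L 1, c, by positivity, hc, fun K _ _ hKn 𝔪 h𝔪 τ x hx ↦ ?_⟩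
  haveI : Finite (RayClassGroup 𝔪) := finite_rayClassGroup h𝔪
  have hK : 1 < Module.finrank ℚ K := by rw [hKn]; exact hn
  set R : ℝ := rayCondQ K 𝔪 with hR
  have hR12 : (12 : ℝ) ≤ R := twelve_le_rayCondQ hK h𝔪
  have hR1 : (1 : ℝ) ≤ R := by linarith
  have hR0 : (0 : ℝ) < R := by linarith
  have hxL : R ^ L ≤ x := (Real.rpow_le_rpow_of_exponent_le hR1 (le_max_left L 1)).trans hx
  have hxR : R ≤ x := by
    have := Real.rpow_le_rpow_of_exponent_le hR1 (le_max_right L 1)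
    rw [Real.rpow_one] at this; exact this.trans hx
  have hlogx : 0 < Real.log x := Real.log_pos (by linarith)
  have hx0 : 0 < x := by linarith
  have hG := natCard_rayClassGroup_le_rayCondQ_pow hK h𝔪
  have hG0 : (0 : ℝ) < (Nat.card (RayClassGroup 𝔪) : ℝ) := by exact_mod_cast Nat.card_pos (α := RayClassGroup 𝔪)
  have h1 := hmain K hKn (RayClassGroup 𝔪) 𝔪 (primeRayClass 𝔪 h𝔪) h𝔪 (artinKillsRay_primeRayClass h𝔪)
    (fun χ hχ ↦ exists_charFun_primeRayClass_ne_one h𝔪 χ hχ) hG x hxL τ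
  refine le_trans ?_ h1
  -- `c x/(R¹² log x) ≤ c R^{-8} x/(|G| log x)` since `|G| ≤ R⁴` and `R^{-8} R^{12} = R^4`
  have hR8 : R ^ (-(8 : ℝ)) * R ^ (12 : ℕ) = R ^ (4 : ℕ) := by
    rw [show (R ^ (12 : ℕ) : ℝ) = R ^ (12 : ℝ) from (Real.rpow_natCast R 12).symm, ← Real.rpow_add hR0,
      show (R ^ (4 : ℕ) : ℝ) = R ^ (4 : ℝ) from (Real.rpow_natCast R 4).symm]
    norm_num
  rw [div_le_div_iff₀ (by positivity) (by positivity)]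
  calc c * x * ((Nat.card (RayClassGroup 𝔪) : ℝ) * Real.log x)
      ≤ c * x * (R ^ (4 : ℕ) * Real.log x) := by gcongr
    _ = c * R ^ (-(8 : ℝ)) * x * (R ^ (12 : ℕ) * Real.log x) := by rw [← hR8]; ring

end Summit.QuantumAdvantage.QuantumAdvantage.Theorems.DegreeOnePrimesEscape

end
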